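import Summits.QuantumFields.YangMills.Theorems.PencilRigidityWeakCouplingHypercubicLimitRPOfTwoShiftProbesAt
import Summits.QuantumFields.YangMills.Theorems.DiagonalMirrorRPRTwoShiftIdentitiesAt
import Summits.QuantumFields.YangMills.Theorems.DiagonalMirrorRPRPinnedProbeReshift
import HarnessLib

/-!
# Crux `WeakCouplingHypercubicLimitRP` (stmt-QuantumFields-27398), door B: the composition with NO FREE INTERFACE TERM —
# D1′-binders + probe arithmetic + letters on `twoShiftProbesAt (twoShiftIdentitiesAt …)` ⇒ `OddTwistGap` ⇒ D1′ / D1, by name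

Helper file (`--supports stmt-QuantumFields-27398 --as helper`) of hand `hand-10604-wilsonDiagModel-3` g0 (docket director-ym g24, O4 WORD 49 (3) /
50 (4) / 51 (2); critic idea-crit-9 g13's strike rule «no use of `twoShiftProbesAt I …` sold as the instance before a CLOSED `I` for the probe of
record lands»).  Item (ii) is now in the tree (hand `hand-10604-wilsonDiagModel-2` g3): ✓`twoShiftIdentitiesAt r sch hβ P hn0 hnge hreg :
TwoShiftIdentities r sch hβ P` — `N_k = side_k`, `d_k = 2T_k + 1`, `Z_k = Tr K_u^{side_k}`, `w_k = ⟪ψ_b, 𝒯_{Y_k} ψ_a⟫²`, both identities PROVED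
(✓`hasSum_twoShift_slicePkgAt`), under three displayed ARITHMETIC hypotheses on the pinned probe `P` (`n_k ≠ 0`, `side_k ≤ 16 n_k`,
`48 n_k + 16 (2T_k + 1) ≤ 5 side_k` eventually — met by `n_k ≍ side_k/16`, `T_k ≤ side_k/16 − O(1)`, e.g. every probe of bounded physical size).
This file substitutes that closed term into the composition file (✓`…HypercubicLimitRPOfTwoShiftProbesAt`), so that the statements of record
carry NO free interface term (def-free, O4 WORD 52 (2)):

* ★ `oddTwistGap_transferModel_of_pinnedProbe` — `RPSpectral r sch Δ C` + the coupling letter `SlowCoupled (twoShiftIdentitiesAt …)` + K1 + K2(`Δ/32`)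
  on the probe data `twoShiftProbesAt (twoShiftIdentitiesAt r sch hβ P hn0 hnge hreg) C hC hc` (every field a formula in Wilson data, read off the
  pinned probe `P`; `PinnedTo P C` by `rfl`) ⇒ R1 `OddTwistGap (wilsonDiagonalTransferModel r sch hβ)`; `oddTorusSwapPairingLiminf_transferModel_of_pinnedProbe(_tepid)`;
* ★ `stub_oddTorusSwapPairingLiminf_of_doorB_pinned` / `stub_diagRPOfPlaneLimits_of_doorB_pinned` — D1′'s / D1's EXACT binder lists followed by
  `β ≥ 0`, located `RPSpectral Δ C`, the pinned probe `P` with its three arithmetic hypotheses, `SlowCoupled`, `M → ∞`, K1, K2, R2♭ `DiagTepid`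
  ⇒ the registered conclusions BY NAME; and the weaker consumed forms `…_pinned_subseq` (everything read only along the witness sub-scheme);
* §3 ★ `stub_oddTorusSwapPairingLiminf_of_doorB_boundedBox` / `stub_diagRPOfPlaneLimits_of_doorB_boundedBox` — the same for a pinned probe of
  BOUNDED PHYSICAL BOX SIZE `a_k T_k ≤ R` with NO arithmetic row left (hand-2 g3's ✓`PinnedProbe.reshift` / ✓`twoShiftIdentitiesOfBoundedBox`:
  the shift re-chosen as `n_k := side_k/16 + 1`).

SECTOR CAVEAT (g13, R-sector / p-V1) as in the composition file: `slowRatio`, K1, K2, `SlowCoupled` are read on the FULL spectrum of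
`slicePkgAt`; the sector-relative variant is the named, un-commissioned repair; no new letter here.  The three arithmetic rows on `P` are a
PRICE on how the probe is built («probe-construction»), discharged for every probe family of bounded physical box size by a choice of the shift
(hand-2 g3's ✓`PinnedProbe.reshift` / ✓`twoShiftIdentitiesOfBoundedBox`, ✓`…DiagonalMirrorRPRPinnedProbeReshift`); §1–§2 keep them displayed, §3 discharges them.

HONEST FRAMING: soft composition; the AXIS letter `RPSpectral`, the coupling letter `SlowCoupled`, K1 `CoarseGap ∧ JunkVisible`, K2 `SlowestVisible`,
R2♭ `DiagTepid` / R2 `DiagLukewarm` are OPEN physics letters about Wilson's measure at weak coupling — none is proved here or anywhere in the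
tree; this file does NOT close D1′; D1′, the crux ⟨27398⟩, its heart S6i and the summit are OPEN; the Yang–Mills mass gap is NOT proved here or
anywhere in the tree.  No definition, no instance, no notation, `autoImplicit false`.

References: Fröhlich–Israel–Lieb–Simon, CMP 62 (1978) Thm 2.1; Osterwalder–Seiler, Ann. Phys. 110 (1978) §2–3.
-/

set_option autoImplicit false

noncomputable section

open scoped SchwartzMap
open MeasureTheory Filter Topology
open Literature.MathematicalPhysics.QuantumLattice Literature.MathematicalPhysics.AQFT
  Literature.MathematicalPhysics.QuantumFieldTheory
open Summit.QuantumFields.YangMills.Cruxes.HypercubicLimit.CouplingResponse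
open Summit.QuantumFields.YangMills.Cruxes.DiagonalMirrorRPR.ParityBridgeColdTraces (E4 DiagonalFrameRP)
open Summit.QuantumFields.YangMills.Cruxes.DiagonalMirrorRPR.SignTwistedDiagonalTrace
open Summit.QuantumFields.YangMills.Cruxes.DiagonalMirrorRPR.SignTwistedDiagonalTrace.WilsonDiagonal
open Summit.QuantumFields.YangMills.Theorems.WeakCouplingHypercubicLimit.TraceNormColdPressure
  (diagRPOfPlaneLimits_of_swapPairingLiminf)
open Summit.QuantumFields.YangMills.Theorems.WeakCouplingHypercubicLimitRP.Negative.OddTorusSwapPairingLiminf (rpSpectral_subseq)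

namespace Summit.QuantumFields.YangMills.Cruxes.DiagonalMirrorRPR.SpectralTransfer

variable {G : Type} [Group G] [TopologicalSpace G] [IsTopologicalGroup G] [CompactSpace G]
  [MeasurableSpace G] [BorelSpace G] (r : LatticeRep G) (sch : SpeciesScheme (YMSpecies G))

/-! ## §1 R1 and the line's lattice statement from the letters on the pinned probe -/

/-- ★ **R1 on the model of record from the letters on a PINNED probe (no free interface term)**: `RPSpectral r sch Δ C` (`Δ > 0`, `C ≥ 0`), a
pinned probe `P` in the arithmetic regime, the coupling letter `SlowCoupled (twoShiftIdentitiesAt …)`, K1 `CoarseGap ∧ JunkVisible` (`M_k → ∞`), K2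
`SlowestVisible (Δ/32)` on `twoShiftProbesAt (twoShiftIdentitiesAt …) C hC hc` ⇒ `OddTwistGap (wilsonDiagonalTransferModel r sch hβ)`. [cite: FrohlichIsraelLiebSimon1978, Thm. 2.1] -/
theorem oddTwistGap_transferModel_of_pinnedProbe (hβ : ∀ k, 0 ≤ sch.β k) (P : PinnedProbe sch) (hn0 : ∀ k, P.n k ≠ 0)
    (hnge : ∀ᶠ k in atTop, (sch.side k : ℝ) ≤ 16 * P.n k)
    (hreg : ∀ᶠ k in atTop, 48 * P.n k + 16 * (2 * P.T k + 1) ≤ 5 * sch.side k) {Δ C : ℝ} {M : ℕ → ℝ}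
    (hΔ : 0 < Δ) (hC : 0 ≤ C) (hc : SlowCoupled (twoShiftIdentitiesAt r sch hβ P hn0 hnge hreg)) (hRP : RPSpectral r sch Δ C)
    (hM : Tendsto M atTop atTop) (hgap : CoarseGap (twoShiftProbesAt (twoShiftIdentitiesAt r sch hβ P hn0 hnge hreg) C hC hc) M)
    (hjunk : JunkVisible (twoShiftProbesAt (twoShiftIdentitiesAt r sch hβ P hn0 hnge hreg) C hC hc) M)
    (hvis : SlowestVisible (twoShiftProbesAt (twoShiftIdentitiesAt r sch hβ P hn0 hnge hreg) C hC hc) (Δ / 32)) :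
    OddTwistGap (wilsonDiagonalTransferModel r sch hβ) :=
  oddTwistGap_transferModel_of_rpSpectral (twoShiftIdentitiesAt r sch hβ P hn0 hnge hreg) hΔ hC hc hRP hM hgap hjunk hvis

/-- **The line's lattice statement on the scheme** from the above with R2 `DiagLukewarm` and `Growth`. [cite: FrohlichIsraelLiebSimon1978, Thm. 2.1] -/
theorem oddTorusSwapPairingLiminf_transferModel_of_pinnedProbe (hβ : ∀ k, 0 ≤ sch.β k) (P : PinnedProbe sch)
    (hn0 : ∀ k, P.n k ≠ 0) (hnge : ∀ᶠ k in atTop, (sch.side k : ℝ) ≤ 16 * P.n k)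
    (hreg : ∀ᶠ k in atTop, 48 * P.n k + 16 * (2 * P.T k + 1) ≤ 5 * sch.side k) {Δ C : ℝ} {M : ℕ → ℝ}
    (hΔ : 0 < Δ) (hC : 0 ≤ C) (hc : SlowCoupled (twoShiftIdentitiesAt r sch hβ P hn0 hnge hreg)) (hRP : RPSpectral r sch Δ C)
    (hM : Tendsto M atTop atTop) (hgap : CoarseGap (twoShiftProbesAt (twoShiftIdentitiesAt r sch hβ P hn0 hnge hreg) C hC hc) M)
    (hjunk : JunkVisible (twoShiftProbesAt (twoShiftIdentitiesAt r sch hβ P hn0 hnge hreg) C hC hc) M)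
    (hvis : SlowestVisible (twoShiftProbesAt (twoShiftIdentitiesAt r sch hβ P hn0 hnge hreg) C hC hc) (Δ / 32))
    (hR2 : DiagLukewarm (wilsonDiagonalTransferModel r sch hβ)) (hG : Growth r sch) :
    OddTorusSwapPairingLiminf r sch :=
  oddTorusSwapPairingLiminf_transferModel_of_rpSpectral (twoShiftIdentitiesAt r sch hβ P hn0 hnge hreg) hΔ hC hc hRP hM hgap hjunk
    hvis hR2 hG

/-- The same with R2♭ `DiagTepid`. [cite: FrohlichIsraelLiebSimon1978, Thm. 2.1] -/
theorem oddTorusSwapPairingLiminf_transferModel_of_pinnedProbe_tepid (hβ : ∀ k, 0 ≤ sch.β k) (P : PinnedProbe sch)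
    (hn0 : ∀ k, P.n k ≠ 0) (hnge : ∀ᶠ k in atTop, (sch.side k : ℝ) ≤ 16 * P.n k)
    (hreg : ∀ᶠ k in atTop, 48 * P.n k + 16 * (2 * P.T k + 1) ≤ 5 * sch.side k) {Δ C : ℝ} {M : ℕ → ℝ}
    (hΔ : 0 < Δ) (hC : 0 ≤ C) (hc : SlowCoupled (twoShiftIdentitiesAt r sch hβ P hn0 hnge hreg)) (hRP : RPSpectral r sch Δ C)
    (hM : Tendsto M atTop atTop) (hgap : CoarseGap (twoShiftProbesAt (twoShiftIdentitiesAt r sch hβ P hn0 hnge hreg) C hC hc) M)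
    (hjunk : JunkVisible (twoShiftProbesAt (twoShiftIdentitiesAt r sch hβ P hn0 hnge hreg) C hC hc) M)
    (hvis : SlowestVisible (twoShiftProbesAt (twoShiftIdentitiesAt r sch hβ P hn0 hnge hreg) C hC hc) (Δ / 32))
    (hR2 : DiagTepid (wilsonDiagonalTransferModel r sch hβ)) (hG : Growth r sch) :
    OddTorusSwapPairingLiminf r sch :=
  oddTorusSwapPairingLiminf_transferModel_of_rpSpectral_tepid (twoShiftIdentitiesAt r sch hβ P hn0 hnge hreg) hΔ hC hc hRP hM hgap
    hjunk hvis hR2 hG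

/-! ## §2 D1′ and D1 modulo the door-B letters on a pinned probe: the registered binder lists, by name -/

/-- ★ **D1′ (`stub_oddTorusSwapPairingLiminf`, ρ1 v2) modulo the door-B letters on a PINNED probe — no free interface term.**  D1′'s EXACT
binder list, followed by: `β_k ≥ 0` (all `k`), the located AXIS letter `RPSpectral r sch Δ C` (`0 < Δ`, `0 ≤ C`), a pinned probe `P` with its
three arithmetic hypotheses, the coupling letter `SlowCoupled (twoShiftIdentitiesAt …)`, `M → ∞`, K1, K2(`Δ/32`) on `twoShiftProbesAt (twoShiftIdentitiesAt …) C hC hc`, and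
R2♭ `DiagTepid (wilsonDiagonalTransferModel r sch hβ)` ⇒ D1′'s conclusion BY NAME.  Does NOT close D1′. [cite: FrohlichIsraelLiebSimon1978, Thm. 2.1] -/
theorem stub_oddTorusSwapPairingLiminf_of_doorB_pinned :
    ∀ (G : Type) [Group G] [TopologicalSpace G] [IsTopologicalGroup G] [CompactSpace G]
      [MeasurableSpace G] [BorelSpace G] (r : LatticeRep G) (sch : SpeciesScheme (YMSpecies G))
      (φ : ℕ → ℕ) (hφ : StrictMono φ)
      (T : (n : ℕ) → (Fin n → Plane) → (𝓢((Fin n → EuclideanSpace ℝ (Fin 4)), ℂ) →L[ℂ] ℂ)),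
      sch.HasWeakCouplingLimit → PolyVolume sch → PolyRenorm r sch → UniformFunctionalBoundPlanes r sch →
        (∃ Δ C : ℝ, 0 < Δ ∧ RPSpectral r sch Δ C) → PlaneLimits r sch φ T →
        ∀ (hβ : ∀ k, 0 ≤ sch.β k) (Δ C : ℝ) (_ : 0 < Δ) (hC : 0 ≤ C), RPSpectral r sch Δ C →
        ∀ (P : PinnedProbe sch) (hn0 : ∀ k, P.n k ≠ 0) (hnge : ∀ᶠ k in atTop, (sch.side k : ℝ) ≤ 16 * P.n k)
          (hreg : ∀ᶠ k in atTop, 48 * P.n k + 16 * (2 * P.T k + 1) ≤ 5 * sch.side k)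
          (hc : SlowCoupled (twoShiftIdentitiesAt r sch hβ P hn0 hnge hreg)) (M : ℕ → ℝ),
          Tendsto M atTop atTop → CoarseGap (twoShiftProbesAt (twoShiftIdentitiesAt r sch hβ P hn0 hnge hreg) C hC hc) M →
          JunkVisible (twoShiftProbesAt (twoShiftIdentitiesAt r sch hβ P hn0 hnge hreg) C hC hc) M →
          SlowestVisible (twoShiftProbesAt (twoShiftIdentitiesAt r sch hβ P hn0 hnge hreg) C hC hc) (Δ / 32) →
          DiagTepid (wilsonDiagonalTransferModel r sch hβ) →
            OddTorusSwapPairingLiminf r (subseq sch φ hφ) := by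
  intro G _ _ _ _ _ _ r sch φ hφ T _ hV hcR hU _ _ hβ Δ C hΔ hC hRP P hn0 hnge hreg hc M hM hgap hjunk hvis hR2
  exact oddTorusSwapPairingLiminf_subseq_transferModel_of_rpSpectral_tepid (twoShiftIdentitiesAt r sch hβ P hn0 hnge hreg) φ hφ hΔ
    hC hc hRP hM hgap hjunk hvis hR2 hcR hU hV

/-- **D1 (`stub_diagRPOfPlaneLimits`) modulo the door-B letters on a pinned probe**: the same list ⇒ `DiagonalFrameRP (planeSum T)` BY NAME.
[cite: FrohlichIsraelLiebSimon1978, Thm. 2.1] -/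
theorem stub_diagRPOfPlaneLimits_of_doorB_pinned :
    ∀ (G : Type) [Group G] [TopologicalSpace G] [IsTopologicalGroup G] [CompactSpace G]
      [MeasurableSpace G] [BorelSpace G] (r : LatticeRep G) (sch : SpeciesScheme (YMSpecies G))
      (φ : ℕ → ℕ) (hφ : StrictMono φ)
      (T : (n : ℕ) → (Fin n → Plane) → (𝓢((Fin n → EuclideanSpace ℝ (Fin 4)), ℂ) →L[ℂ] ℂ)),
      sch.HasWeakCouplingLimit → PolyVolume sch → PolyRenorm r sch → UniformFunctionalBoundPlanes r sch →
        (∃ Δ C : ℝ, 0 < Δ ∧ RPSpectral r sch Δ C) → PlaneLimits r sch φ T →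
        ∀ (hβ : ∀ k, 0 ≤ sch.β k) (Δ C : ℝ) (_ : 0 < Δ) (hC : 0 ≤ C), RPSpectral r sch Δ C →
        ∀ (P : PinnedProbe sch) (hn0 : ∀ k, P.n k ≠ 0) (hnge : ∀ᶠ k in atTop, (sch.side k : ℝ) ≤ 16 * P.n k)
          (hreg : ∀ᶠ k in atTop, 48 * P.n k + 16 * (2 * P.T k + 1) ≤ 5 * sch.side k)
          (hc : SlowCoupled (twoShiftIdentitiesAt r sch hβ P hn0 hnge hreg)) (M : ℕ → ℝ),
          Tendsto M atTop atTop → CoarseGap (twoShiftProbesAt (twoShiftIdentitiesAt r sch hβ P hn0 hnge hreg) C hC hc) M →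
          JunkVisible (twoShiftProbesAt (twoShiftIdentitiesAt r sch hβ P hn0 hnge hreg) C hC hc) M →
          SlowestVisible (twoShiftProbesAt (twoShiftIdentitiesAt r sch hβ P hn0 hnge hreg) C hC hc) (Δ / 32) →
          DiagTepid (wilsonDiagonalTransferModel r sch hβ) →
            DiagonalFrameRP (planeSum T) := by
  intro G _ _ _ _ _ _ r sch φ hφ T _ hV hcR hU _ hPL hβ Δ C hΔ hC hRP P hn0 hnge hreg hc M hM hgap hjunk hvis hR2
  exact diagonalFrameRP_transferModel_of_rpSpectral_tepid (twoShiftIdentitiesAt r sch hβ P hn0 hnge hreg) φ hφ T hΔ hC hc hRP hM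
    hgap hjunk hvis hR2 hcR hU hV hPL

/-- ★ **D1′ modulo the door-B letters on a pinned probe OF THE WITNESS SUB-SCHEME** (the weaker consumed form: probe, coupling letter, K1, K2,
R2♭ read only along `subseq sch φ hφ`; `RPSpectral` transported by ✓`rpSpectral_subseq`; `Growth` of the sub-scheme from D1′'s own binders).
Does NOT close D1′. [cite: FrohlichIsraelLiebSimon1978, Thm. 2.1] -/
theorem stub_oddTorusSwapPairingLiminf_of_doorB_pinned_subseq :
    ∀ (G : Type) [Group G] [TopologicalSpace G] [IsTopologicalGroup G] [CompactSpace G]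
      [MeasurableSpace G] [BorelSpace G] (r : LatticeRep G) (sch : SpeciesScheme (YMSpecies G))
      (φ : ℕ → ℕ) (hφ : StrictMono φ)
      (T : (n : ℕ) → (Fin n → Plane) → (𝓢((Fin n → EuclideanSpace ℝ (Fin 4)), ℂ) →L[ℂ] ℂ)),
      sch.HasWeakCouplingLimit → PolyVolume sch → PolyRenorm r sch → UniformFunctionalBoundPlanes r sch →
        (∃ Δ C : ℝ, 0 < Δ ∧ RPSpectral r sch Δ C) → PlaneLimits r sch φ T →
        ∀ (hβ : ∀ k, 0 ≤ (subseq sch φ hφ).β k) (Δ C : ℝ) (_ : 0 < Δ) (hC : 0 ≤ C), RPSpectral r sch Δ C →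
        ∀ (P : PinnedProbe (subseq sch φ hφ)) (hn0 : ∀ k, P.n k ≠ 0)
          (hnge : ∀ᶠ k in atTop, ((subseq sch φ hφ).side k : ℝ) ≤ 16 * P.n k)
          (hreg : ∀ᶠ k in atTop, 48 * P.n k + 16 * (2 * P.T k + 1) ≤ 5 * (subseq sch φ hφ).side k)
          (hc : SlowCoupled (twoShiftIdentitiesAt r (subseq sch φ hφ) hβ P hn0 hnge hreg)) (M : ℕ → ℝ),
          Tendsto M atTop atTop → CoarseGap (twoShiftProbesAt (twoShiftIdentitiesAt r (subseq sch φ hφ) hβ P hn0 hnge hreg) C hC hc) M →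
          JunkVisible (twoShiftProbesAt (twoShiftIdentitiesAt r (subseq sch φ hφ) hβ P hn0 hnge hreg) C hC hc) M →
          SlowestVisible (twoShiftProbesAt (twoShiftIdentitiesAt r (subseq sch φ hφ) hβ P hn0 hnge hreg) C hC hc) (Δ / 32) →
          DiagTepid (wilsonDiagonalTransferModel r (subseq sch φ hφ) hβ) →
            OddTorusSwapPairingLiminf r (subseq sch φ hφ) := by
  intro G _ _ _ _ _ _ r sch φ hφ T _ hV hcR hU _ _ hβ Δ C hΔ hC hRP P hn0 hnge hreg hc M hM hgap hjunk hvis hR2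
  exact oddTorusSwapPairingLiminf_transferModel_of_rpSpectral_tepid (twoShiftIdentitiesAt r (subseq sch φ hφ) hβ P hn0 hnge hreg) hΔ hC
    hc (rpSpectral_subseq r sch φ hφ hRP) hM hgap hjunk hvis hR2 (growth_subseq_of_polyRenorm_of_ufbPlanes r sch hcR hU hV φ hφ)

/-- **D1 modulo the door-B letters on a pinned probe of the witness sub-scheme**: the same list ⇒ `DiagonalFrameRP (planeSum T)`.
[cite: FrohlichIsraelLiebSimon1978, Thm. 2.1] -/
theorem stub_diagRPOfPlaneLimits_of_doorB_pinned_subseq :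
    ∀ (G : Type) [Group G] [TopologicalSpace G] [IsTopologicalGroup G] [CompactSpace G]
      [MeasurableSpace G] [BorelSpace G] (r : LatticeRep G) (sch : SpeciesScheme (YMSpecies G))
      (φ : ℕ → ℕ) (hφ : StrictMono φ)
      (T : (n : ℕ) → (Fin n → Plane) → (𝓢((Fin n → EuclideanSpace ℝ (Fin 4)), ℂ) →L[ℂ] ℂ)),
      sch.HasWeakCouplingLimit → PolyVolume sch → PolyRenorm r sch → UniformFunctionalBoundPlanes r sch →
        (∃ Δ C : ℝ, 0 < Δ ∧ RPSpectral r sch Δ C) → PlaneLimits r sch φ T →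
        ∀ (hβ : ∀ k, 0 ≤ (subseq sch φ hφ).β k) (Δ C : ℝ) (_ : 0 < Δ) (hC : 0 ≤ C), RPSpectral r sch Δ C →
        ∀ (P : PinnedProbe (subseq sch φ hφ)) (hn0 : ∀ k, P.n k ≠ 0)
          (hnge : ∀ᶠ k in atTop, ((subseq sch φ hφ).side k : ℝ) ≤ 16 * P.n k)
          (hreg : ∀ᶠ k in atTop, 48 * P.n k + 16 * (2 * P.T k + 1) ≤ 5 * (subseq sch φ hφ).side k)
          (hc : SlowCoupled (twoShiftIdentitiesAt r (subseq sch φ hφ) hβ P hn0 hnge hreg)) (M : ℕ → ℝ),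
          Tendsto M atTop atTop → CoarseGap (twoShiftProbesAt (twoShiftIdentitiesAt r (subseq sch φ hφ) hβ P hn0 hnge hreg) C hC hc) M →
          JunkVisible (twoShiftProbesAt (twoShiftIdentitiesAt r (subseq sch φ hφ) hβ P hn0 hnge hreg) C hC hc) M →
          SlowestVisible (twoShiftProbesAt (twoShiftIdentitiesAt r (subseq sch φ hφ) hβ P hn0 hnge hreg) C hC hc) (Δ / 32) →
          DiagTepid (wilsonDiagonalTransferModel r (subseq sch φ hφ) hβ) →
            DiagonalFrameRP (planeSum T) := by
  intro G _ _ _ _ _ _ r sch φ hφ T _ hV hcR hU _ hPL hβ Δ C hΔ hC hRP P hn0 hnge hreg hc M hM hgap hjunk hvis hR2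
  exact diagRPOfPlaneLimits_of_swapPairingLiminf G r sch φ hφ T hU hPL
    ((oddTorusSwapPairingLiminf_iff r _).1
      (oddTorusSwapPairingLiminf_transferModel_of_rpSpectral_tepid (twoShiftIdentitiesAt r (subseq sch φ hφ) hβ P hn0 hnge hreg)
        hΔ hC hc (rpSpectral_subseq r sch φ hφ hRP) hM hgap hjunk hvis hR2
        (growth_subseq_of_polyRenorm_of_ufbPlanes r sch hcR hU hV φ hφ)))

/-! ## §3 Probes of bounded physical box size: NO arithmetic row left (hand-2 g3's re-shift) -/

/-- ★ **D1′ modulo the door-B letters on a pinned probe of BOUNDED PHYSICAL BOX SIZE** — D1′'s EXACT binder list, followed by: `β_k ≥ 0`, the located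
AXIS letter `RPSpectral r sch Δ C` (`0 < Δ`, `0 ≤ C`), a pinned probe `P` with `a_k T_k ≤ R` eventually (its shift re-chosen as `n_k := side_k/16 + 1` by
✓`PinnedProbe.reshift`; the contract inhabited by ✓`twoShiftIdentitiesOfBoundedBox r hβ P hR` with NO residual arithmetic hypothesis), the coupling
letter `SlowCoupled (twoShiftIdentitiesOfBoundedBox r hβ P hR)`, `M → ∞`, K1, K2(`Δ/32`) on `twoShiftProbesAt (twoShiftIdentitiesOfBoundedBox r hβ P hR) C hC hc`,
and R2♭ `DiagTepid (wilsonDiagonalTransferModel r sch hβ)` ⇒ D1′'s conclusion BY NAME.  Does NOT close D1′. [cite: FrohlichIsraelLiebSimon1978, Thm. 2.1] -/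
theorem stub_oddTorusSwapPairingLiminf_of_doorB_boundedBox :
    ∀ (G : Type) [Group G] [TopologicalSpace G] [IsTopologicalGroup G] [CompactSpace G]
      [MeasurableSpace G] [BorelSpace G] (r : LatticeRep G) (sch : SpeciesScheme (YMSpecies G))
      (φ : ℕ → ℕ) (hφ : StrictMono φ)
      (T : (n : ℕ) → (Fin n → Plane) → (𝓢((Fin n → EuclideanSpace ℝ (Fin 4)), ℂ) →L[ℂ] ℂ)),
      sch.HasWeakCouplingLimit → PolyVolume sch → PolyRenorm r sch → UniformFunctionalBoundPlanes r sch →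
        (∃ Δ C : ℝ, 0 < Δ ∧ RPSpectral r sch Δ C) → PlaneLimits r sch φ T →
        ∀ (hβ : ∀ k, 0 ≤ sch.β k) (Δ C : ℝ) (_ : 0 < Δ) (hC : 0 ≤ C), RPSpectral r sch Δ C →
        ∀ (P : PinnedProbe sch) (R : ℝ) (hR : ∀ᶠ k in atTop, sch.a k * P.T k ≤ R)
          (hc : SlowCoupled (twoShiftIdentitiesOfBoundedBox r hβ P hR)) (M : ℕ → ℝ),
          Tendsto M atTop atTop → CoarseGap (twoShiftProbesAt (twoShiftIdentitiesOfBoundedBox r hβ P hR) C hC hc) M →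
          JunkVisible (twoShiftProbesAt (twoShiftIdentitiesOfBoundedBox r hβ P hR) C hC hc) M →
          SlowestVisible (twoShiftProbesAt (twoShiftIdentitiesOfBoundedBox r hβ P hR) C hC hc) (Δ / 32) →
          DiagTepid (wilsonDiagonalTransferModel r sch hβ) →
            OddTorusSwapPairingLiminf r (subseq sch φ hφ) := by
  intro G _ _ _ _ _ _ r sch φ hφ T _ hV hcR hU _ _ hβ Δ C hΔ hC hRP P R hR hc M hM hgap hjunk hvis hR2
  exact oddTorusSwapPairingLiminf_subseq_transferModel_of_rpSpectral_tepid (twoShiftIdentitiesOfBoundedBox r hβ P hR) φ hφ hΔ hC hc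
    hRP hM hgap hjunk hvis hR2 hcR hU hV

/-- **D1 modulo the door-B letters on a pinned probe of bounded physical box size**: the same list ⇒ `DiagonalFrameRP (planeSum T)` BY NAME.
[cite: FrohlichIsraelLiebSimon1978, Thm. 2.1] -/
theorem stub_diagRPOfPlaneLimits_of_doorB_boundedBox :
    ∀ (G : Type) [Group G] [TopologicalSpace G] [IsTopologicalGroup G] [CompactSpace G]
      [MeasurableSpace G] [BorelSpace G] (r : LatticeRep G) (sch : SpeciesScheme (YMSpecies G))
      (φ : ℕ → ℕ) (hφ : StrictMono φ)
      (T : (n : ℕ) → (Fin n → Plane) → (𝓢((Fin n → EuclideanSpace ℝ (Fin 4)), ℂ) →L[ℂ] ℂ)),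
      sch.HasWeakCouplingLimit → PolyVolume sch → PolyRenorm r sch → UniformFunctionalBoundPlanes r sch →
        (∃ Δ C : ℝ, 0 < Δ ∧ RPSpectral r sch Δ C) → PlaneLimits r sch φ T →
        ∀ (hβ : ∀ k, 0 ≤ sch.β k) (Δ C : ℝ) (_ : 0 < Δ) (hC : 0 ≤ C), RPSpectral r sch Δ C →
        ∀ (P : PinnedProbe sch) (R : ℝ) (hR : ∀ᶠ k in atTop, sch.a k * P.T k ≤ R)
          (hc : SlowCoupled (twoShiftIdentitiesOfBoundedBox r hβ P hR)) (M : ℕ → ℝ),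
          Tendsto M atTop atTop → CoarseGap (twoShiftProbesAt (twoShiftIdentitiesOfBoundedBox r hβ P hR) C hC hc) M →
          JunkVisible (twoShiftProbesAt (twoShiftIdentitiesOfBoundedBox r hβ P hR) C hC hc) M →
          SlowestVisible (twoShiftProbesAt (twoShiftIdentitiesOfBoundedBox r hβ P hR) C hC hc) (Δ / 32) →
          DiagTepid (wilsonDiagonalTransferModel r sch hβ) →
            DiagonalFrameRP (planeSum T) := by
  intro G _ _ _ _ _ _ r sch φ hφ T _ hV hcR hU _ hPL hβ Δ C hΔ hC hRP P R hR hc M hM hgap hjunk hvis hR2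
  exact diagonalFrameRP_transferModel_of_rpSpectral_tepid (twoShiftIdentitiesOfBoundedBox r hβ P hR) φ hφ T hΔ hC hc hRP hM
    hgap hjunk hvis hR2 hcR hU hV hPL

end Summit.QuantumFields.YangMills.Cruxes.DiagonalMirrorRPR.SpectralTransfer

end
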